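import Literature.AlgebraicGeometry.HodgeTheory.GenericFibreClosedSubsetSpreadIntegralBase
import HarnessLib

/-!
# Spreading a closed subset of the fibre over a generic complex point — smooth affine parameter space

`exists_spread_isClosed_fiberOver_generic_of_isIntegral` (Charles–Schnell, *Notes on absolute
Hodge classes*, §11.3.3, Remark after Cor. 11.3.16: the spread `Z ⊆ 𝒳₀ ×_B T` of a subvariety of
a very general fibre over a variety `T` dominating the base) with the parameter scheme `T₀` made
SMOOTH over `k` (characteristic zero): the integral affine `T₀` of finite type over `k` produced
by the spread is generically smooth over the perfect field `k` (Mathlib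
`Scheme.Hom.genericPoint_mem_smoothLocus_of_perfectField`), so an affine open neighbourhood `U` of
its generic point inside the smooth locus is smooth over `k`; the complex point `t` over the
generic point factors through `U ⊗ ℂ`, the family, the closed subset and the fibre identification
restrict to `U` (the fibre does not change: `exists_fiberOver_iso_of_isPullback` for the
cartesian square of the restriction, Görtz–Wedhorn I, Prop. 4.16), and `U → S₀` is still dominant.
Smoothness of the parameter space is what the relative Ehresmann theorem over the complex points
of `T₀ ⊗ ℂ` needs downstream (Voisin, *Hodge Theory II*, §3.3.1).
-/

noncomputable section

open CategoryTheory CategoryTheory.Limits AlgebraicGeometry TopologicalSpace Opposite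

set_option backward.isDefEq.respectTransparency false

namespace Literature.AlgebraicGeometry.HodgeTheory

open Literature.AlgebraicGeometry.Motives

section Spread

variable {k : Type} [Field k] [CharZero k] (σ : k →+* ℂ) {𝒳₀ S₀ : SchemeOver k} (f₀ : 𝒳₀ ⟶ S₀)

omit [CharZero k] in
/-- Over a locally Noetherian base, locally of finite type implies locally of finite presentation
(a copy of `locallyOfFinitePresentation_of_isLocallyNoetherian` of `AlgebraicityLocusCurves`, to
keep the imports of this file light). [folklore] -/
private theorem locallyOfFinitePresentation_of_isLocallyNoetherian'' {X Y : Scheme} (g : X ⟶ Y)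
    [IsLocallyNoetherian Y] [LocallyOfFiniteType g] : LocallyOfFinitePresentation g := by
  rw [HasRingHomProperty.iff_appLE (P := @LocallyOfFinitePresentation)]
  intro U V e
  haveI := IsLocallyNoetherian.component_noetherian (X := Y) U
  exact RingHom.FinitePresentation.of_finiteType.mp
    (HasRingHomProperty.appLE @LocallyOfFiniteType g inferInstance U V e)

omit [CharZero k] in
/-- The complement of the preimage of a set with compact complement under an isomorphism of schemes
is compact. [folklore] -/
private theorem isCompact_compl_preimage_of_iso' {X Y : Scheme} (e : X ≅ Y) {V : Set Y}
    (hVc : IsCompact Vᶜ) : IsCompact (e.hom ⁻¹' V)ᶜ := by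
  rw [← Set.preimage_compl]
  exact (Scheme.homeoOfIso e).isCompact_preimage.2 hVc

/-- **Spread of a closed subset of the fibre over a complex point lying over the generic point,
over a SMOOTH affine parameter scheme.** Let `k` have characteristic zero, `f₀ : 𝒳₀ ⟶ S₀` over
`k` with `S₀` integral and locally of finite type, `σ : k →+* ℂ`, `s` a complex point of
`S₀ ⊗_σ ℂ` over the generic point of `S₀`, and `V ⊆ (f₀ ⊗ ℂ)⁻¹(s)` closed with quasi-compact
complement. Then there are an integral affine `T₀`, SMOOTH over `k`, a dominant `h₀ : T₀ ⟶ S₀`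
locally of finite type, a cartesian square `(q₀, g₀; f₀, h₀)`, a closed `Z ⊆ 𝒲₀`, a complex
point `t` of `T₀ ⊗ ℂ` over the generic point of `T₀` with `h(t) = s`, and an isomorphism over
`Spec ℂ` of the fibre of `g₀ ⊗ ℂ` over `t` with the fibre of `f₀ ⊗ ℂ` over `s`, compatible with
the inclusions, carrying the slice of `Z` onto `V`.
[cite: CharlesSchnell2014Notes, Remark after Cor. 11.3.16 and Lemma 11.3.14]
[cite: GortzWedhorn2020, Prop. 4.16 and Thm. 6.28] -/
theorem exists_spread_isClosed_fiberOver_generic_smooth [IsIntegral S₀.left]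
    [LocallyOfFiniteType S₀.hom] (s : ComplexPoints ((baseChangeHom σ).obj S₀))
    (hs : baseChangeHomFst σ S₀ s.pt = genericPoint S₀.left)
    {V : Set (fiberOver ((baseChangeHom σ).map f₀) s).left} (hV : IsClosed V) (hVc : IsCompact Vᶜ) :
    ∃ (T₀ 𝒲₀ : SchemeOver k) (_ : IsAffine T₀.left) (_ : IsIntegral T₀.left) (_ : Smooth T₀.hom)
      (h₀ : T₀ ⟶ S₀) (_ : LocallyOfFiniteType h₀.left) (_ : IsDominant h₀.left)
      (g₀ : 𝒲₀ ⟶ T₀) (q₀ : 𝒲₀ ⟶ 𝒳₀) (Z : Set 𝒲₀.left)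
      (t : ComplexPoints ((baseChangeHom σ).obj T₀))
      (e : fiberOver ((baseChangeHom σ).map g₀) t ≅ fiberOver ((baseChangeHom σ).map f₀) s),
      IsPullback q₀.left g₀.left f₀.left h₀.left ∧ IsClosed Z ∧
      AlgPoints.map ((baseChangeHom σ).map h₀) t = s ∧
      baseChangeHomFst σ T₀ t.pt = genericPoint T₀.left ∧
      e.hom ≫ fiberι ((baseChangeHom σ).map f₀) s =
        fiberι ((baseChangeHom σ).map g₀) t ≫ (baseChangeHom σ).map q₀ ∧
      e.hom.left ⁻¹' V =
        ((fiberι ((baseChangeHom σ).map g₀) t).left ≫ baseChangeHomFst σ 𝒲₀) ⁻¹' Z := by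
  classical
  letI := σ.toAlgebra
  haveI : PerfectField k := PerfectField.ofCharZero
  haveI : Subsingleton ↥(specOver ℂ ℂ).left := inferInstanceAs (Subsingleton (PrimeSpectrum ℂ))
  -- ### the spread over the integral base
  obtain ⟨T₀, 𝒲₀, hT₀aff, hT₀int, h₀, hlft, hdom, g₀, q₀, Z, t, e, Hsq, hZ, hts, hgen, hcomp,
    hslice⟩ := exists_spread_isClosed_fiberOver_generic_of_isIntegral σ f₀ s hs hV hVc
  haveI := hT₀aff
  haveI := hT₀int
  haveI := hlft
  haveI := hdom
  -- ### an affine open of `T₀` around the generic point, smooth over `k`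
  haveI : LocallyOfFiniteType T₀.hom := by rw [← Over.w h₀]; infer_instance
  haveI : LocallyOfFinitePresentation T₀.hom :=
    locallyOfFinitePresentation_of_isLocallyNoetherian'' T₀.hom
  have hηsm : genericPoint T₀.left ∈ T₀.hom.smoothLocus :=
    T₀.hom.genericPoint_mem_smoothLocus_of_perfectField
  obtain ⟨_, ⟨U', hU, rfl⟩, hηU', hUsm⟩ := T₀.left.isBasis_affineOpens.exists_subset_of_mem_open
    hηsm T₀.hom.smoothLocus.isOpen
  let U : T₀.left.Opens := U'
  have hηU : genericPoint T₀.left ∈ U := hηU'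
  haveI : Nonempty U.toScheme := ⟨⟨_, hηU⟩⟩
  -- ### the restricted parameter scheme and family
  let T₁ : SchemeOver k := Over.mk (U.ι ≫ T₀.hom)
  haveI : IsAffine T₁.left := hU
  haveI hT₁int : IsIntegral T₁.left := inferInstanceAs (IsIntegral U.toScheme)
  have hT₁sm : Smooth T₁.hom := by
    change Smooth (U.ι ≫ T₀.hom)
    rw [← Scheme.Hom.smoothLocus_eq_top_iff, ← Scheme.Hom.preimage_smoothLocus_eq, eq_top_iff]
    intro x _
    exact hUsm x.2
  let i : T₁ ⟶ T₀ := Over.homMk U.ι rfl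
  let 𝒲₁ : SchemeOver k := Over.mk ((g₀.left ⁻¹ᵁ U).ι ≫ 𝒲₀.hom)
  let i' : 𝒲₁ ⟶ 𝒲₀ := Over.homMk (g₀.left ⁻¹ᵁ U).ι rfl
  have hg₁w : (g₀.left ∣_ U) ≫ T₁.hom = 𝒲₁.hom := by
    change (g₀.left ∣_ U) ≫ U.ι ≫ T₀.hom = (g₀.left ⁻¹ᵁ U).ι ≫ 𝒲₀.hom
    rw [← Category.assoc, morphismRestrict_ι, Category.assoc, Over.w g₀]
  let g₁ : 𝒲₁ ⟶ T₁ := Over.homMk (g₀.left ∣_ U) hg₁w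
  have Hres : IsPullback i'.left g₁.left g₀.left i.left := (isPullback_morphismRestrict g₀.left U).flip
  have HresC := isPullback_baseChangeHom_map_of_isPullback' σ Hres
  -- ### `t` factors through the open `U ⊗ ℂ ⊆ T₀ ⊗ ℂ`
  have Hi : IsPullback ((baseChangeHom σ).map i).left (baseChangeHomFst σ T₁)
      (baseChangeHomFst σ T₀) i.left := isPullback_baseChange_map_left ℂ i
  haveI : IsOpenImmersion ((baseChangeHom σ).map i).left :=
    MorphismProperty.of_isPullback (P := @IsOpenImmersion) Hi.flip
      (inferInstanceAs (IsOpenImmersion U.ι))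
  have hrange : Set.range t.left ⊆ Set.range ((baseChangeHom σ).map i).left := by
    rintro _ ⟨x, rfl⟩
    obtain rfl : x = IsLocalRing.closedPoint ℂ := Subsingleton.elim _ _
    change t.pt ∈ Set.range ((baseChangeHom σ).map i).left
    obtain ⟨z, hz, -⟩ := Scheme.Pullback.exists_preimage_pullback (f := baseChangeHomFst σ T₀)
      (g := i.left) t.pt ⟨genericPoint T₀.left, hηU⟩ (by rw [hgen]; rfl)
    refine ⟨Hi.isoPullback.inv z, ?_⟩
    rw [← hz, ← Scheme.Hom.comp_apply, IsPullback.isoPullback_inv_fst]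
  obtain ⟨t₁, rfl⟩ : ∃ t₁ : ComplexPoints ((baseChangeHom σ).obj T₁),
      AlgPoints.map ((baseChangeHom σ).map i) t₁ = t := by
    refine ⟨Over.homMk (IsOpenImmersion.lift ((baseChangeHom σ).map i).left t.left hrange) ?_, ?_⟩
    · rw [← Over.w ((baseChangeHom σ).map i), ← Category.assoc, IsOpenImmersion.lift_fac]
      exact Over.w t
    · ext : 1
      exact IsOpenImmersion.lift_fac _ _ _
  -- `t₁` lies over the generic point of `U`
  have hgen₁ : baseChangeHomFst σ T₁ t₁.pt = genericPoint T₁.left := by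
    apply U.ι.injective
    have hη : U.ι (genericPoint T₁.left) = genericPoint T₀.left :=
      genericPoint_eq_of_isOpenImmersion (X := T₁.left) U.ι
    rw [hη]
    change i.left (baseChangeHomFst σ T₁ t₁.pt) = genericPoint T₀.left
    rw [← Scheme.Hom.comp_apply, ← Hi.w, Scheme.Hom.comp_apply]
    exact hgen
  -- ### the fibre over `t₁` is the fibre over `t`
  obtain ⟨ε, hε⟩ := exists_fiberOver_iso_of_isPullback HresC t₁
  -- ### conclusion
  haveI : IsDominant U.ι := by
    refine ⟨?_⟩
    change Dense (Set.range U.ι)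
    rw [Scheme.Opens.range_ι]
    intro x
    have hη : x ∈ closure ({genericPoint T₀.left} : Set T₀.left) := by
      rw [genericPoint_closure]; trivial
    exact closure_mono (Set.singleton_subset_iff.2 hηU) hη
  refine ⟨T₁, 𝒲₁, inferInstance, hT₁int, hT₁sm, i ≫ h₀,
    inferInstanceAs (LocallyOfFiniteType (U.ι ≫ h₀.left)),
    inferInstanceAs (IsDominant (U.ι ≫ h₀.left)), g₁, i' ≫ q₀,
    (i'.left : 𝒲₁.left → 𝒲₀.left) ⁻¹' Z, t₁, ε ≪≫ e, Hres.paste_horiz Hsq,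
    hZ.preimage i'.left.continuous, ?_, hgen₁, ?_, ?_⟩
  · -- `h(t) = s`
    rw [Functor.map_comp, AlgPoints.map_comp_apply]
    exact hts
  · -- compatibility with the inclusions
    rw [Iso.trans_hom, Category.assoc, hcomp, ← Category.assoc, hε, Category.assoc,
      ← Functor.map_comp]
  · -- the slice
    have hnat : ((baseChangeHom σ).map i').left ≫ baseChangeHomFst σ 𝒲₀ =
        baseChangeHomFst σ 𝒲₁ ≫ i'.left := baseChangeHom_map_left_comp_fst σ i'
    have hεl : ε.hom.left ≫ (fiberι ((baseChangeHom σ).map g₀)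
        (AlgPoints.map ((baseChangeHom σ).map i) t₁)).left =
        (fiberι ((baseChangeHom σ).map g₁) t₁).left ≫ ((baseChangeHom σ).map i').left := by
      have h := congrArg CommaMorphism.left hε
      simpa using h
    have key : (fiberι ((baseChangeHom σ).map g₁) t₁).left ≫ baseChangeHomFst σ 𝒲₁ ≫ i'.left =
        ε.hom.left ≫ (fiberι ((baseChangeHom σ).map g₀)
          (AlgPoints.map ((baseChangeHom σ).map i) t₁)).left ≫ baseChangeHomFst σ 𝒲₀ := by
      rw [← hnat, ← Category.assoc, ← hεl, Category.assoc]
    rw [Iso.trans_hom, Over.comp_left, Scheme.Hom.comp_base, TopCat.coe_comp, Set.preimage_comp,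
      hslice, ← Set.preimage_comp, ← Set.preimage_comp]
    change _ = ((fiberι ((baseChangeHom σ).map g₁) t₁).left ≫ baseChangeHomFst σ 𝒲₁ ≫ i'.left).base ⁻¹' Z
    rw [key]
    rfl

end Spread

end Literature.AlgebraicGeometry.HodgeTheory

end
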